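import Literature.MathematicalPhysics.QuantumLattice.KomaPiFluxGroundStateKLSBound
import Literature.MathematicalPhysics.QuantumLattice.KomaPiFluxKuboInequality
import Literature.MathematicalPhysics.QuantumLattice.XYOrderIntegralProofs

/-!
# K2D — sibling-model witness (Koma π-flux BCS pair-hopping fermions, d = 2, T = 0), grade VARIANT
# (method in print), BC5-style rung for PC-class routes; NOT a statement about the Hubbard model;
# PC / H0 crux coverage UNCHANGED by it.

**Label of record** (hubbard-cq lead, NAMING WORD 2026-08-28; director-hubbard CYCLE-13 (D)): «sibling-model
witness (Koma π-flux BCS pair-hopping fermions, d = 2, T = 0), grade VARIANT (method in print), BC5-style rung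
for PC-class routes; NOT a statement about the Hubbard model; PC / H0 crux coverage UNCHANGED by it».

**What is proved** (Lieb frame of the tree's `KomaPiFlux` series, `H₀ = KomaPiFlux.hamiltonian κ U g 0 0` on
the even two-dimensional torus `FermionTorus 2 (2k)` = Koma's arXiv:2201.13135 (2.4)–(2.9) after the
particle–hole/gauge dictionary of `KomaPiFluxPrintedModel`/`KomaPiFluxPrintedLongRangeOrder`):

* `groundState_superconductingOrder_two`: for `g > 0`, `|κ| ≤ g/10000`, `U + 4g ≤ 0` there is `k₀` with
  `groundLroSq H₀ ≥ 1/250` on every torus of side `2k ≥ 2k₀` — staggered on-site pairing long-range order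
  in the finite-volume ground states (2.13), uniformly in the volume, in TWO dimensions;
* `printed_groundState_superconductingOrder_two`: for the printed Hamiltonian (2.4)–(2.9) (`U = -4g` in
  the Lieb frame) the zero-temperature limit of Koma's `m^{(Λ)}_LRO` ((2.11)) exists and is `≥ 1/16`.

**J₂ entry mode (lead ruling, one mode)**: NO numerics and NO computational leaf. The d = 2 kernel is
controlled analytically: the pointwise Kennedy–Lieb–Shastry kernel `{C_q}₊√(E⁺_q/E_q)` is EXACTLY
`2·F₂(q)` and `{C_q}₊/√E_q ≤ √2·F₂(q)` (`F_ν` the KLS integrand, tree `klsIntegrand`), so both error terms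
are governed by the tree's certified Riemann-sum bound `klsRiemannSum_le`:
`I_Λ(2) ≤ 3√2/(2π) + 2√2(1 + log L)/L` (`3√2/(2π) = 0.675…`), used here as `I_Λ(2) ≤ 0.68` for large `L`.
(The census' number `J₂ = 0.48864` with Koma's printed constant `1/(2βgE_p)` is NOT used: the tree's
Lieb-frame infrared bound carries `1/(βgE_p)`, under which criterion (A) of the census fails at `κ = 0`; the
rescue is the genuinely pointwise KLS route with Kubo's inequality, margin `≈ 0.0053 ≥ 1/250` at `κ/g = 10⁻⁴`.)

**Proof** (all steps are tree theorems of the `KomaPiFlux` series, proved — no named fact, no sorry):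
`KomaPiFlux.ground_kls_bound` (pointwise infrared bound at `T = 0` + sum rule + `η`-rotation and direction
symmetries + hopping bound, [KLS1988PRL, (4)–(8)], [Koma2022, §6]) with Kubo's inequality
`KomaPiFlux.kubo_inequality` ([KLS1988PRL, after (4)]) gives `e₁ ≤ m² + I_Λ√{e₁}₊ + 2√(κ/g)I_Λ`;
`KomaPiFlux.groundNnCorr_ge` (Koma's Lemma 6.1 at `T = 0`) gives `e₁ ≥ ½ - 4κ/g ≥ 0.4996`; with
`I_Λ ≤ 0.68` the scalar inequality `margin` yields `m² ≥ 1/250`. Negative `κ` by the `κ ↦ -κ` symmetry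
(`lroSq_neg_kappa`).
-/

set_option linter.dupNamespace false

noncomputable section

namespace Summit.HubbardSuperconductivity.HubbardSuperconductivity.Theorems.KomaPiFluxGroundStateLRO2D

open Finset Filter Topology Matrix
open Literature.MathematicalPhysics.QuantumLattice Literature.Probability.LatticeModels
open HubbardWave0 PairHopRP FermionTorus LiebCutRP KomaPiFlux

/-- In two dimensions the KLS Riemann sums are eventually `≤ 0.68` (`3√2/(2π) = 0.6752…` plus the
`O((1 + log L)/L)` boundary-cell error of `klsRiemannSum_le`). [cite: KLS1988PRL, after eq. (8)] -/
theorem klsRiemannSum_two_eventually_le : ∀ᶠ L : ℕ in atTop, klsRiemannSum 2 L ≤ 0.68 := by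
  obtain ⟨C, hC⟩ : ∃ C : ℝ, C = ((2 : ℕ) : ℝ) * ((2 : ℕ) - 1) * Real.sqrt ((2 : ℕ)) := ⟨_, rfl⟩
  have hlim : Tendsto (fun L : ℕ => C * ((1 + Real.log L) / (L : ℝ))) atTop (𝓝 (C * 0)) :=
    tendsto_one_add_log_div_nat.const_mul C
  rw [mul_zero] at hlim
  have h3 : 3 * Real.sqrt 2 / (2 * Real.pi) < 0.676 := by
    have hsqrt2 : Real.sqrt 2 < 1.4143 := by
      rw [Real.sqrt_lt' (by norm_num)]
      norm_num
    rw [div_lt_iff₀ (by positivity)]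
    nlinarith [Real.pi_gt_d4]
  filter_upwards [hlim.eventually_lt_const (show (0 : ℝ) < 0.004 by norm_num), eventually_ne_atTop 0] with L hL hL0
  haveI : NeZero L := ⟨hL0⟩
  have hR := klsRiemannSum_le 0 L
  rw [zero_add, ← hC] at hR
  have : C * ((1 + Real.log L) / (L : ℝ)) = C * (1 + Real.log L) / L := by ring
  rw [this] at hL
  linarith

/-- The scalar endgame: `e ≥ 0.4996`, `I ≤ 0.68`, `0 ≤ √(κ/g) ≤ 1/100` and `e ≤ m + I√{e}₊ + 2√(κ/g)I` force
`m ≥ 1/250` (`e - 0.68√e ≥ 0.0189` for `√e ≥ 0.7068`). [folklore] -/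
theorem margin {e m R t : ℝ} (he : 0.4996 ≤ e) (hR : R ≤ 0.68) (ht : t ≤ 1 / 100) (ht0 : 0 ≤ t)
    (h : e ≤ m + R * Real.sqrt (max e 0) + 2 * t * R) : 1 / 250 ≤ m := by
  have he0 : 0 ≤ e := by linarith
  rw [max_eq_left he0] at h
  have hs0 : 0 ≤ Real.sqrt e := Real.sqrt_nonneg e
  have hse : Real.sqrt e ^ 2 = e := Real.sq_sqrt he0
  have hs1 : 0.7068 ≤ Real.sqrt e := by
    rw [Real.le_sqrt' (by norm_num)]
    linarith
  have hRs : R * Real.sqrt e ≤ 0.68 * Real.sqrt e := mul_le_mul_of_nonneg_right hR hs0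
  have htR : 2 * t * R ≤ 2 * (1 / 100) * 0.68 := by nlinarith
  have hp : 0 ≤ (Real.sqrt e - 0.7068) * (Real.sqrt e + 0.0268) := mul_nonneg (by linarith) (by linarith)
  nlinarith

/-- `groundLroSq` is even in `κ` (limit of `lroSq_neg_kappa`). [cite: Koma2022, (2.7)–(2.9)] -/
theorem groundLroSq_neg_kappa {d L : ℕ} [NeZero L] (hL : Even L) (h2 : 2 ≤ L) (κ U g : ℝ) :
    groundLroSq (hamiltonian (-κ) U g (fun (_ _ : FermionTorus (d + 1) L) => (0 : ℝ)) 0) =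
      groundLroSq (hamiltonian κ U g (fun (_ _ : FermionTorus (d + 1) L) => (0 : ℝ)) 0) := by
  have hH1 : (hamiltonian (-κ) U g (fun (_ _ : FermionTorus (d + 1) L) => (0 : ℝ)) 0).IsHermitian :=
    hamiltonian_isHermitian (G d L) (piFluxAmpl (-κ)) (piFluxAmpl_herm (-κ)) U g _ 0
  have hH2 : (hamiltonian κ U g (fun (_ _ : FermionTorus (d + 1) L) => (0 : ℝ)) 0).IsHermitian :=
    hamiltonian_isHermitian (G d L) (piFluxAmpl κ) (piFluxAmpl_herm κ) U g _ 0
  exact tendsto_nhds_unique (tendsto_lroSq_atTop hH1)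
    ((tendsto_lroSq_atTop hH2).congr fun β => (lroSq_neg_kappa hL h2 β κ U g).symm)

/-- **The KLS ground-state bound, unconditional** (Kubo's inequality discharged by
`KomaPiFlux.kubo_inequality`): `e₁ ≤ m² + I_Λ√{e₁}₊ + 2√(κ/g)I_Λ` for `H₀ = H(κ,U;g,0;0)`, `κ ≥ 0`, `g > 0`,
even `L ≥ 4`, any `d`. [cite: KLS1988PRL, eqs. (4)–(7)] [cite: Koma2022, §6] -/
theorem ground_kls_bound' {d L : ℕ} [NeZero L] (hL : Even L) (h4 : 4 ≤ L) {κ : ℝ} (hκ : 0 ≤ κ) (U : ℝ) {g : ℝ}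
    (hg : 0 < g) :
    groundNnCorr (hamiltonian κ U g (fun (_ _ : FermionTorus (d + 1) L) => (0 : ℝ)) 0) ≤
      groundLroSq (hamiltonian κ U g (fun (_ _ : FermionTorus (d + 1) L) => (0 : ℝ)) 0) +
        klsRiemannSum (d + 1) L *
          Real.sqrt (max (groundNnCorr (hamiltonian κ U g (fun (_ _ : FermionTorus (d + 1) L) => (0 : ℝ)) 0)) 0) +
        2 * Real.sqrt (κ / g) * klsRiemannSum (d + 1) L := by
  refine ground_kls_bound hL h4 hκ U hg ?_
  -- `kubo_inequality` is stated with the series' default `DecidableEq` instance on the torus; `convert`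
  -- identifies the (subsingleton) instance arguments.
  convert kubo_inequality (d := d) (L := L) hL (by omega : 3 ≤ L) κ U hg

/-- **Ground-state staggered pairing long-range order in two dimensions** (Lieb frame): for `g > 0`,
`|κ| ≤ g/10000` and `U + 4g ≤ 0` there is `k₀` such that on every torus `(ℤ/2kℤ)²`, `k ≥ k₀`, the tracial
ground state of `H₀ = H(κ, U; g, 0; 0)` has `|Λ|⁻² Σ_{x,y} Re ω₀(Γ¹_xΓ¹_y) ≥ 1/250`.
Sibling-model witness (Koma π-flux BCS pair-hopping fermions, d = 2, T = 0), grade VARIANT (method in print),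
BC5-style rung for PC-class routes; NOT a statement about the Hubbard model; PC / H0 crux coverage UNCHANGED by it.
[cite: KLS1988PRL, eqs. (4)–(8)] [cite: Koma2022, Theorem 2.1 (d ≥ 3, T > 0), (2.13), §6] -/
theorem groundState_superconductingOrder_two {κ U g : ℝ} (hg : 0 < g) (hκg : |κ| ≤ g / 10000) (hU : U + 4 * g ≤ 0) :
    ∃ k₀ : ℕ, ∀ k : ℕ, k₀ ≤ k → ∀ [NeZero (2 * k)],
      (1 / 250 : ℝ) ≤ groundLroSq (hamiltonian κ U g (fun (_ _ : FermionTorus (1 + 1) (2 * k)) => (0 : ℝ)) 0) := by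
  suffices hpos : ∀ κ : ℝ, 0 ≤ κ → κ ≤ g / 10000 → ∃ k₀ : ℕ, ∀ k : ℕ, k₀ ≤ k → ∀ [NeZero (2 * k)],
      (1 / 250 : ℝ) ≤ groundLroSq (hamiltonian κ U g (fun (_ _ : FermionTorus (1 + 1) (2 * k)) => (0 : ℝ)) 0) by
    rcases le_or_gt 0 κ with hκ | hκ
    · rw [abs_of_nonneg hκ] at hκg
      exact hpos κ hκ hκg
    · rw [abs_of_neg hκ] at hκg
      obtain ⟨k₀, h⟩ := hpos (-κ) (by linarith) hκg
      refine ⟨max k₀ 2, fun k hk _ => ?_⟩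
      have h' := h k (le_trans (le_max_left _ _) hk)
      rwa [groundLroSq_neg_kappa (even_two_mul k) (by omega)] at h'
  intro κ hκ hκg
  obtain ⟨L₀, hL₀⟩ := Filter.eventually_atTop.1 klsRiemannSum_two_eventually_le
  refine ⟨max L₀ 2, fun k hk _ => ?_⟩
  have hk2 : 2 ≤ k := le_trans (le_max_right _ _) hk
  have hL4 : 4 ≤ 2 * k := by omega
  have hR : klsRiemannSum (1 + 1) (2 * k) ≤ 0.68 := hL₀ (2 * k) (by omega)
  have hkls := ground_kls_bound' (d := 1) (L := 2 * k) (even_two_mul k) hL4 hκ U hg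
  have hlow := groundNnCorr_ge (d := 1) (L := 2 * k) (even_two_mul k) hL4 hκ U hg
  have hm0 : max (U + 2 * g * ((1 : ℕ) + 1 : ℝ)) 0 = 0 := max_eq_right (by push_cast; linarith)
  rw [hm0, zero_div, sub_zero] at hlow
  have h4κ : 4 * κ / g ≤ 4 / 10000 := by
    rw [div_le_iff₀ hg]
    linarith
  have ht : Real.sqrt (κ / g) ≤ 1 / 100 := by
    rw [show (1 / 100 : ℝ) = Real.sqrt ((1 / 100) ^ 2) by rw [Real.sqrt_sq (by norm_num)]]
    exact Real.sqrt_le_sqrt (by rw [div_le_iff₀ hg]; linarith)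
  exact margin (by linarith) hR ht (Real.sqrt_nonneg _) hkls

/-- **The printed model, two dimensions, zero temperature**: for Koma's Hamiltonian (2.4)–(2.9) in `d = 2`
(`U = -4g` in the Lieb frame) with `g > 0`, `|κ| ≤ g/10000`, there is `k₀` such that on every torus of side
`2k ≥ 2k₀` the zero-temperature limit `lim_{β→∞} m^{(Λ)}_LRO` of the staggered pairing order parameter
(2.11) exists and is at least `1/16`. Sibling-model witness (Koma π-flux BCS pair-hopping fermions,
d = 2, T = 0), grade VARIANT (method in print); NOT a statement about the Hubbard model; PC / H0 crux
coverage UNCHANGED by it. [cite: Koma2022, (2.4)–(2.13), Theorem 2.1 (printed for d ≥ 3)] [cite: KLS1988PRL, eqs. (4)–(8)] -/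
theorem printed_groundState_superconductingOrder_two {κ g : ℝ} (hg : 0 < g) (hκg : |κ| ≤ g / 10000) :
    ∃ k₀ : ℕ, ∀ k : ℕ, k₀ ≤ k → ∀ [NeZero (2 * k)], ∃ m₀ : ℝ, (1 / 16 : ℝ) ≤ m₀ ∧
      Tendsto (fun β : ℝ => mLRO (d := 1) (L := 2 * k) β κ g) atTop (𝓝 m₀) := by
  have hU : (-2 * (1 + 1 : ℕ) * g : ℝ) + 4 * g ≤ 0 := by push_cast; linarith
  obtain ⟨k₀, h⟩ := groundState_superconductingOrder_two hg hκg hU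
  refine ⟨max k₀ 2, fun k hk _ => ⟨_, ?_, tendsto_mLRO_atTop (even_two_mul k) (by omega) κ g⟩⟩
  have h' := h k (le_trans (le_max_left _ _) hk)
  calc (1 / 16 : ℝ) = Real.sqrt ((1 / 16) ^ 2) := (Real.sqrt_sq (by norm_num)).symm
    _ ≤ Real.sqrt (1 / 250) := Real.sqrt_le_sqrt (by norm_num)
    _ ≤ _ := Real.sqrt_le_sqrt h'

end Summit.HubbardSuperconductivity.HubbardSuperconductivity.Theorems.KomaPiFluxGroundStateLRO2D

end
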